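import Summits.HodgeConjecture.HodgeConjecture.Theses.HeckePrymWeil
import Summits.HodgeConjecture.HodgeConjecture.Theorems.HeckePrymWeilWeilTwelvefoldsSqrtMinus7Descent
import Summits.HodgeConjecture.HodgeConjecture.Theorems.HeckePrymWeilWeilTwelvefoldsSqrtMinus7HodgeTypeExterior
import Literature.AlgebraicGeometry.Motives.AbelianVarietyProduct
import Literature.AlgebraicGeometry.Motives.AimedSplitProductProofs
import Literature.NumberTheory.Transcendental.DeRhamTheoremMultiplicative
import HarnessLib

/-!
# Crux `WeilTwelvefoldsSqrtMinus7` (stmt-HodgeConjecture-1261) · `IdeatorTwoSketch.AimedDescentFourteen` PROVED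

Route `HeckePrymWeil` (sub-problem `HodgeConjecture`); lead seat a1 of crux `WeilTwelvefoldsSqrtMinus7`,
payload line `IdeatorTwoSketch` (ideator k = 2, card `subproduct-secant-sheaves`).  The sketch
(`Cruxes/WeilTwelvefoldsSqrtMinus7/IdeatorTwoSketch.lean`) states the aimed descent `14 → 12` cut down to
products — `AimedDescentFourteen : HyperbolicProductFourteenfolds → WeilTwelvefoldsSqrtMinus7` — as a
`def … : Prop` "statement only — its proof needs Künneth for `complexBetti` of `A.prod B` and a
push-forward preserving `algebraicClasses`".  Both are in the tree now (Künneth for Hodge types: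
`stub_hodgeTypeExterior` fed by `exists_deRhamIsoFamily_holds`; Schoen's transfer along `complexGysin`:
`stub_descent`; a Weil surface with a descent pair for every `d`: `Motives.exists_weilSurface_descentPair`),
so the implication is a THEOREM (`aimedDescentFourteen`, hypothesis = the body of
`IdeatorTwo.HyperbolicProductFourteenfolds` verbatim, conclusion = the crux by name).  It does not move the
crux: the hypothesis — Hodge–Weil for the diagonal `ℚ(√-7)`-action on `A × B`, `A` any Weil 12-fold, `B` any
Weil surface — is an open instance of the Hodge conjecture one rung ABOVE the crux (cf. the dead line
`amnesic-secant-sheaves-split-fourteenfolds`, stuck at the hyperbolic-14-fold rung).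
-/

noncomputable section

-- every declaration of this problem lives in `Summit.HodgeConjecture.HodgeConjecture.…` (summit = sub-problem)
set_option linter.dupNamespace false

open CategoryTheory Complex
open Literature.AlgebraicGeometry Literature.AlgebraicGeometry.Motives
  Literature.AlgebraicGeometry.HodgeTheory Literature.AlgebraicTopology.SingularHomology
open Summit.HodgeConjecture.HodgeConjecture.Theses.HeckePrymWeil
open Summit.HodgeConjecture.HodgeConjecture.Theorems.WeilTwelvefoldsSqrtMinus7.AmnesicSecantSheaves

namespace Summit.HodgeConjecture.HodgeConjecture.Theorems.WeilTwelvefoldsSqrtMinus7.SubproductSecantSheaves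

/-- **Aimed descent `14 → 12` on products (`IdeatorTwoSketch.AimedDescentFourteen`, PROVED).** If the
rational `(7,7)` classes in the typed Weil plane of `(A × B, φ × ψ)` are algebraic for every `ℚ(√-7)`-Weil
12-fold `(A, φ)` and every `ℚ(√-7)`-Weil surface `(B, ψ)` (diagonal action `prodLift (fst ≫ φ) (snd ≫ ψ)`),
then `WeilTwelvefoldsSqrtMinus7` holds.  Proof: take the Weil surface with a descent pair
(`exists_weilSurface_descentPair 7`: `B = E × E`, companion-matrix `ψ`, `b± ⌣ η ≠ 0`), apply the hypothesis
on `A × B`, and descend with Schoen's transfer `stub_descent` fed by Künneth for Hodge types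
(`stub_hodgeTypeExterior` + `exists_deRhamIsoFamily_holds`).
[cite: Schoen1998HodgeWeilAddendum, §10] [cite: vanGeemen1994HodgeAV, Lemma 5.2 and 5.4] -/
theorem aimedDescentFourteen :
    (∀ (A : AbelianVariety ℂ) (φ : A ⟶ A) (B : AbelianVariety ℂ) (ψ : B ⟶ B),
      A.dim = 12 → B.dim = 2 → φ ≫ φ = -((7 : ℤ) • 𝟙 A) → ψ ≫ ψ = -((7 : ℤ) • 𝟙 B) →
      ∀ c : complexBetti (A.prod B).X (2 * 7), IsRationalClass c →
        IsOfHodgeType 14 (A.prod B).X (2 * 7) 7 7 c →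
        c ∈ Module.End.eigenspace
              (complexBetti.map
                (𝟙 (A.prod B) + AbelianVariety.prodLift
                  (AbelianVariety.fst A B ≫ φ) (AbelianVariety.snd A B ≫ ψ)).hom.hom.hom
                (2 * 7)).hom ((1 + Complex.I * (Real.sqrt (7 : ℝ) : ℂ)) ^ 14) ⊔
            Module.End.eigenspace
              (complexBetti.map
                (𝟙 (A.prod B) + AbelianVariety.prodLift
                  (AbelianVariety.fst A B ≫ φ) (AbelianVariety.snd A B ≫ ψ)).hom.hom.hom
                (2 * 7)).hom ((1 - Complex.I * (Real.sqrt (7 : ℝ) : ℂ)) ^ 14) →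
        c ∈ algebraicClasses (A.prod B).X 7) →
    WeilTwelvefoldsSqrtMinus7 := by
  intro h14 A φ hA hφ c hrat hH hW
  obtain ⟨B, ψ, hB, hψ, hpair⟩ := exists_weilSurface_descentPair 7
  exact stub_descent
    (stub_hodgeTypeExterior fun E _ _ _ =>
      Literature.NumberTheory.Transcendental.exists_deRhamIsoFamily_holds E)
    A φ B ψ hA hB hφ hψ hpair (h14 A φ B ψ hA hB hφ hψ) c hrat hH hW

end Summit.HodgeConjecture.HodgeConjecture.Theorems.WeilTwelvefoldsSqrtMinus7.SubproductSecantSheaves
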